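import Literature.Algebra.Homology.CyclicGroupRingProductDecomposition
import Mathlib.FieldTheory.Separable
import Mathlib.Algebra.Algebra.Pi
import HarnessLib

/-!
# The group algebra of a cyclic group of order `n`: `k[G] ≅ ∏_{d ∣ n} k[X]/(Φ_d)` (`n ∈ kˣ`),
# `ℚ[G] ≅ ∏_{d ∣ n} ℚ(ζ_d)`, and the projections `k[G] → k[X]/(Φ_d)`, `σ ↦ ζ_d`, onto with kernel
# `(Φ_d(σ))` (Swan, *The Grothendieck ring of a finite group*, §6)

Topic `Algebra/Homology`; namespace `Literature.Algebra.Homology.CyclicGroupRing` (continued from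
`CyclicGroupRingCyclotomic` — `groupRingEquiv : k[X]/(Xⁿ - 1) ≃ₐ[k] k[G]` — and
`CyclicGroupRingProductDecomposition` — `adjoinRootCyclotomicRatEquiv : ℚ[X]/(Φ_n) ≃ₐ[ℚ] ℚ(ζ_n)`,
the prime case `ℚ[G] ≅ ℚ × ℚ(ζ_p)` after Serre — both used BY NAME); definitions with bodies (the
algebra maps) and theorems; NO named fact, no `sorry`, no instance / notation.  Lane
`lit-hodgefound` (Track 2 foundations library), seat p30 gen 28, row g28-#3 of
`run/shared/lean/pub/lit-hodgefound/SKELETON.md`.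

Source followed, VERBATIM.  R. G. Swan, *The Grothendieck ring of a finite group*, Topology 2
(1963) 85–110 [held copy `paper:doi-10-1016-0040-9383-63-90025-9`, chunk p0013 = printed p. 97],
§6: "If `K = ℚ`, `R = ℤ`, and `π` is cyclic of order `n`, `ℚπ` is the direct sum of the cyclotomic
fields `K_d = ℚ(e(d⁻¹))` where `d` runs over the divisors of `n` and `e(x)` means `e^{2πix}`. The
maximal order `𝔬` of `ℚπ` is the direct sum of the maximal orders `𝔬_d` of the cyclotomic fields.
The projection `ℚπ → K_d` sends `ℤπ` into `𝔬_d`. If `x` is a generator of `π`, this map takes `x`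
into a primitive `d`th root of unity. Since the roots of unity form an integral base of `𝔬_d`
[16, §27], we see that `ℤπ → 𝔬_d` is onto and its kernel is the ideal of `ℤπ` generated by
`Φ_d(x)`, `Φ_d` being the `d`th cyclotomic polynomial."

Dictionary and architecture.  `G` is a finite commutative group with a generator `σ`
(`hσ : ∀ x, x ∈ Subgroup.zpowers σ`), `n = Fintype.card G`; `k[G] = MonoidAlgebra k G`;
`k[X]/(f) = AdjoinRoot f`; `Φ_d = cyclotomic d k`; the divisors of `n` are the Finset `n.divisors`,
and "direct sum over `d ∣ n`" is the `k`-algebra `Π d : n.divisors, k[X]/(Φ_d)`.  Swan's statement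
is over `ℚ`; we prove the ring-theoretic core over ANY commutative ring `k` in which `n` is a unit:
(1) `Xⁿ - 1 = ∏_{d ∣ n} Φ_d` (Mathlib `prod_cyclotomic_eq_X_pow_sub_one`) with PAIRWISE COMAXIMAL
factors, because `Xⁿ - 1` is separable when `n ∈ kˣ` (Mathlib `separable_X_pow_sub_C_unit`,
`Separable.isCoprime`) — `isCoprime_cyclotomic_of_dvd`; (2) the Chinese remainder theorem
`k[X]/(Xⁿ - 1) ≅ Π_{d ∣ n} k[X]/(Φ_d)` (Mathlib `Ideal.quotientInfRingEquivPiQuotient`, made a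
`k`-algebra isomorphism) — `adjoinRootXPowSubOneEquivPi`; (3) composed with `k[G] ≅ k[X]/(Xⁿ - 1)`:
`groupRingEquivPi : k[G] ≃ₐ[k] Π_{d ∣ n} k[X]/(Φ_d)`, `σ ↦ (ζ_d)_d`; (4) over `ℚ`, factorwise
`ℚ[X]/(Φ_d) ≅ K_d` for ANY family of `d`-th cyclotomic fields `K_d` (`ratGroupRingEquivPi`), in
particular Mathlib's `CyclotomicField d ℚ` (`ratGroupRingEquivCyclotomicFields`), with the
dimension count `Σ_{d ∣ n} φ(d) = n`.  The projections (5) `k[G] → k[X]/(Φ_d)`, `σ ↦ ζ_d`, exist for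
every `d ∣ n` over EVERY `k` (no unit hypothesis): onto, kernel `(Φ_d(σ))` — `toCyclotomicFactor`,
`ker_toCyclotomicFactor`; Swan's integral form "`ℤπ → 𝔬_d` is onto with kernel `(Φ_d(x))`" is
given for prime-power `d = p^j` (`intToRingOfIntegers`), where Mathlib knows `𝔬_d = ℤ[ζ_d]`
(`IsPrimitiveRoot.adjoinEquivRingOfIntegersOfPrimePow`).
-- TODO(general form): `ℤ[G] → 𝓞(ℚ(ζ_d))` onto for composite `d` needs `𝓞(ℚ(ζ_d)) = ℤ[ζ_d]` for
-- all `d`, which Mathlib proves only for prime powers.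

## What is formalised

* §1 `separable_X_pow_sub_one`, `isCoprime_cyclotomic_of_dvd`, `pairwise_isCoprime_span_cyclotomic`,
  `iInf_span_cyclotomic`, **`adjoinRootXPowSubOneEquivPi k n hu : k[X]/(Xⁿ - 1) ≃ₐ[k]
  Π d : n.divisors, k[X]/(Φ_d)`** (`_mk`: `P̄ ↦ (P̄)_d` by `rfl`, `_root`).
* §2 **`toCyclotomicFactor k σ hσ hd : k[G] →ₐ[k] k[X]/(Φ_d)`** for `d ∣ |G|`, any `k`
  (`_groupRingEquiv_mk`, `_aeval`: `P(σ) ↦ P̄`, `_of_generator`: `σ ↦ ζ_d`, `_surjective`,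
  **`ker_toCyclotomicFactor` = `(Φ_d(σ))`**); `ker_algHomOfDvd` (the kernel of
  `k[X]/(f) → k[X]/(g)`, `g ∣ f`, is `(ḡ)`), `cyclotomic_dvd_X_pow_card_sub_one`.
* §3 **`groupRingEquivPi k σ hσ hu : k[G] ≃ₐ[k] Π d : |G|.divisors, k[X]/(Φ_d)`**
  (`_of_generator`: `σ ↦ (ζ_d)_d`; `groupRingEquivPi_apply` = `toCyclotomicFactor` componentwise).
* §4 (`k = ℚ`) **`ratGroupRingEquivPi σ hσ K : ℚ[G] ≃ₐ[ℚ] Π d : |G|.divisors, K d`** for any family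
  of `d`-th cyclotomic fields (`_of_generator_apply`: `σ ↦ (ζ_d)_d`,
  **`isPrimitiveRoot_ratGroupRingEquivPi_of_generator`**: each component of the image of `σ` is a
  primitive `d`-th root of unity, `_aeval`: the `d`-th component is `P(σ) ↦ P(ζ_d)`),
  **`ratGroupRingEquivCyclotomicFields : ℚ[G] ≃ₐ[ℚ] Π d : |G|.divisors, CyclotomicField d ℚ`**,
  `finrank_rat_pi_cyclotomicField` (`Σ_{d ∣ n} [K_d : ℚ] = n`), `finrank_rat_monoidAlgebra`
  (`dim ℚ[G] = n`).
* §5 (`k = ℤ`, `d = p ^ j`) `adjoinRootCyclotomicPrimePowEquivRingOfIntegers K :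
  ℤ[X]/(Φ_{p^j}) ≃ₐ[ℤ] 𝓞 K` (`coe_…_root`: `X̄ ↦ ζ_{p^j}`), **`intToRingOfIntegers K σ hσ hd :
  ℤ[G] →ₐ[ℤ] 𝓞 K` (`p^j ∣ |G|`; `coe_…_of_generator`: `σ ↦ ζ_{p^j}`, `_surjective`,
  `ker_intToRingOfIntegers = (Φ_{p^j}(σ))`)**.

## References
* R. G. Swan, *The Grothendieck ring of a finite group*, Topology 2 (1963) 85–110, §6 (p. 97).
  [Swan1963]
* J.-P. Serre, *Local Fields*, GTM 67, Springer (1979), VIII §5 (a) (the case `n = p`). [Serre1979]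
-/

noncomputable section

open Polynomial

universe u

namespace Literature.Algebra.Homology

namespace CyclicGroupRing

/-! ## §1 `k[X]/(Xⁿ - 1) ≅ Π_{d ∣ n} k[X]/(Φ_d)` for `n` a unit of `k` -/

section CRT

variable (k : Type u) [CommRing k] (n : ℕ) [NeZero n]

omit [NeZero n] in
/-- `Xⁿ - 1` is separable over any commutative ring in which `n` is a unit. [cite: Swan1963, §6 (p. 97)] -/
theorem separable_X_pow_sub_one (hu : IsUnit (n : k)) : Separable (X ^ n - 1 : k[X]) := by
  have h := separable_X_pow_sub_C_unit (1 : kˣ) hu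
  rwa [Units.val_one, map_one] at h

/-- **Distinct cyclotomic factors of `Xⁿ - 1` are comaximal** when `n ∈ kˣ`: for `d ≠ e` dividing
`n`, `Φ_d Φ_e ∣ Xⁿ - 1 = ∏_{c ∣ n} Φ_c`, which is separable. [cite: Swan1963, §6 (p. 97)] -/
theorem isCoprime_cyclotomic_of_dvd (hu : IsUnit (n : k)) {d e : ℕ} (hd : d ∣ n) (he : e ∣ n)
    (hde : d ≠ e) : IsCoprime (cyclotomic d k) (cyclotomic e k) := by
  refine Separable.isCoprime ((separable_X_pow_sub_one k n hu).of_dvd ?_)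
  rw [← prod_cyclotomic_eq_X_pow_sub_one (NeZero.pos n) k,
    ← Finset.prod_pair (f := fun c => cyclotomic c k) hde]
  refine Finset.prod_dvd_prod_of_subset _ _ _ fun c hc => ?_
  simp only [Finset.mem_insert, Finset.mem_singleton] at hc
  rcases hc with rfl | rfl
  · exact Nat.mem_divisors.2 ⟨hd, NeZero.ne n⟩
  · exact Nat.mem_divisors.2 ⟨he, NeZero.ne n⟩

/-- The ideals `(Φ_d)`, `d ∣ n`, of `k[X]` are pairwise comaximal (`n ∈ kˣ`). [cite: Swan1963, §6 (p. 97)] -/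
theorem pairwise_isCoprime_span_cyclotomic (hu : IsUnit (n : k)) :
    Pairwise (Function.onFun IsCoprime fun d : n.divisors => Ideal.span {cyclotomic (d : ℕ) k}) :=
  fun d e hde => (Ideal.isCoprime_span_singleton_iff _ _).2
    (isCoprime_cyclotomic_of_dvd k n hu (Nat.dvd_of_mem_divisors d.2) (Nat.dvd_of_mem_divisors e.2)
      fun h => hde (Subtype.ext h))

/-- `⋂_{d ∣ n} (Φ_d) = (∏_{d ∣ n} Φ_d) = (Xⁿ - 1)` in `k[X]` (`n ∈ kˣ`). [cite: Swan1963, §6 (p. 97)] -/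
theorem iInf_span_cyclotomic (hu : IsUnit (n : k)) :
    ⨅ d : n.divisors, Ideal.span {cyclotomic (d : ℕ) k} = Ideal.span {(X ^ n - 1 : k[X])} := by
  rw [Ideal.iInf_span_singleton fun d e hde => isCoprime_cyclotomic_of_dvd k n hu
      (Nat.dvd_of_mem_divisors d.2) (Nat.dvd_of_mem_divisors e.2) fun h => hde (Subtype.ext h),
    Finset.prod_coe_sort n.divisors fun c => cyclotomic c k,
    prod_cyclotomic_eq_X_pow_sub_one (NeZero.pos n)]

/-- **`k[X]/(Xⁿ - 1) ≅ Π_{d ∣ n} k[X]/(Φ_d)` as `k`-algebras, `P̄ ↦ (P̄)_{d ∣ n}`**, for every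
commutative ring `k` in which `n` is a unit (Chinese remainder theorem for the pairwise comaximal
factors `Φ_d` of `Xⁿ - 1`): "`ℚπ` is the direct sum of the cyclotomic fields `K_d` … where `d` runs
over the divisors of `n`". [cite: Swan1963, §6 (p. 97)] -/
def adjoinRootXPowSubOneEquivPi (hu : IsUnit (n : k)) :
    AdjoinRoot (X ^ n - 1 : k[X]) ≃ₐ[k] Π d : n.divisors, AdjoinRoot (cyclotomic (d : ℕ) k) :=
  (Ideal.quotientEquivAlgOfEq k (iInf_span_cyclotomic k n hu).symm).trans
    (AlgEquiv.ofRingEquiv (f := Ideal.quotientInfRingEquivPiQuotient _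
      (pairwise_isCoprime_span_cyclotomic k n hu)) (fun _ => rfl))

/-- `P̄ ↦ (P̄)_d`. [cite: Swan1963, §6 (p. 97)] -/
@[simp]
theorem adjoinRootXPowSubOneEquivPi_mk (hu : IsUnit (n : k)) (P : k[X]) :
    adjoinRootXPowSubOneEquivPi k n hu (AdjoinRoot.mk _ P) =
      fun d : n.divisors => AdjoinRoot.mk (cyclotomic (d : ℕ) k) P :=
  rfl

/-- `X̄ ↦ (ζ_d)_d` (`ζ_d = X̄ ∈ k[X]/(Φ_d)`). [cite: Swan1963, §6 (p. 97)] -/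
@[simp]
theorem adjoinRootXPowSubOneEquivPi_root (hu : IsUnit (n : k)) :
    adjoinRootXPowSubOneEquivPi k n hu (AdjoinRoot.root _) =
      fun d : n.divisors => AdjoinRoot.root (cyclotomic (d : ℕ) k) :=
  rfl

end CRT

/-! ## §2 The projections `k[G] → k[X]/(Φ_d)`, `σ ↦ ζ_d` (`d ∣ |G|`, any `k`) -/

section Factor

variable (k : Type u) [CommRing k]

/-- `k[X]/(f) → k[X]/(g)` (`g ∣ f`) sends `P̄` to `P̄`. [folklore] -/
private theorem algHomOfDvd_mk {f g : k[X]} (hgf : g ∣ f) (P : k[X]) :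
    AdjoinRoot.algHomOfDvd k f g hgf (AdjoinRoot.mk f P) = AdjoinRoot.mk g P := by
  rw [← AdjoinRoot.aeval_eq, ← aeval_algHom_apply, AdjoinRoot.algHomOfDvd_root, AdjoinRoot.aeval_eq]

/-- The kernel of `k[X]/(f) → k[X]/(g)` (`g ∣ f`) is the principal ideal `(ḡ)`.
[cite: Swan1963, §6 (p. 97) ("its kernel is the ideal … generated by `Φ_d(x)`")] -/
theorem ker_algHomOfDvd {f g : k[X]} (hgf : g ∣ f) :
    RingHom.ker (AdjoinRoot.algHomOfDvd k f g hgf) = Ideal.span {AdjoinRoot.mk f g} := by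
  refine le_antisymm (fun x hx => ?_) ((Ideal.span_singleton_le_iff_mem _).2 ?_)
  · obtain ⟨P, rfl⟩ := AdjoinRoot.mk_surjective x
    rw [RingHom.mem_ker, algHomOfDvd_mk, AdjoinRoot.mk_eq_zero] at hx
    obtain ⟨q, rfl⟩ := hx
    rw [map_mul]
    exact Ideal.mul_mem_right _ _ (Ideal.mem_span_singleton_self _)
  · rw [RingHom.mem_ker, algHomOfDvd_mk, AdjoinRoot.mk_self]

variable {G : Type u} [CommGroup G] [Fintype G] (σ : G) (hσ : ∀ x, x ∈ Subgroup.zpowers σ)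
  {d : ℕ} (hd : d ∣ Fintype.card G)

omit [CommGroup G] in
include hd in
/-- `Φ_d ∣ Xⁿ - 1` for `d ∣ n = |G|` (Mathlib `cyclotomic.dvd_X_pow_sub_one`, `X^d - 1 ∣ X^{dc} - 1`).
[cite: Swan1963, §6 (p. 97)] -/
theorem cyclotomic_dvd_X_pow_card_sub_one : cyclotomic d k ∣ (X ^ Fintype.card G - 1 : k[X]) := by
  obtain ⟨c, hc⟩ := hd
  rw [hc]
  exact (cyclotomic.dvd_X_pow_sub_one d k).trans (pow_one_sub_dvd_pow_mul_sub_one X d c)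

/-- **The projection `k[G] → k[X]/(Φ_d)`, `σ ↦ ζ_d = X̄`, for `d ∣ |G|`** ("The projection
`ℚπ → K_d` … If `x` is a generator of `π`, this map takes `x` into a primitive `d`th root of
unity"): `k[G] ≅ k[X]/(Xⁿ - 1) → k[X]/(Φ_d)`, over every commutative ring `k`.
[cite: Swan1963, §6 (p. 97)] -/
def toCyclotomicFactor : MonoidAlgebra k G →ₐ[k] AdjoinRoot (cyclotomic d k) :=
  (AdjoinRoot.algHomOfDvd k _ _ (cyclotomic_dvd_X_pow_card_sub_one k hd)).comp
    ((groupRingEquiv k σ hσ).symm : MonoidAlgebra k G →ₐ[k] AdjoinRoot (X ^ Fintype.card G - 1 : k[X]))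

/-- On `k[X]/(Xⁿ - 1) ≅ k[G]`: `P̄ ↦ P̄`. [cite: Swan1963, §6 (p. 97)] -/
theorem toCyclotomicFactor_groupRingEquiv_mk (P : k[X]) :
    toCyclotomicFactor k σ hσ hd (groupRingEquiv k σ hσ (AdjoinRoot.mk _ P)) = AdjoinRoot.mk _ P := by
  rw [toCyclotomicFactor, AlgHom.comp_apply, AlgEquiv.coe_toAlgHom, AlgEquiv.symm_apply_apply,
    algHomOfDvd_mk]

/-- `P(σ) ↦ P̄`. [cite: Swan1963, §6 (p. 97)] -/
theorem toCyclotomicFactor_aeval (P : k[X]) :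
    toCyclotomicFactor k σ hσ hd (aeval (MonoidAlgebra.of k G σ) P) = AdjoinRoot.mk _ P := by
  rw [← groupRingEquiv_mk k σ hσ, toCyclotomicFactor_groupRingEquiv_mk]

/-- **`σ ↦ ζ_d`** ("this map takes `x` into a primitive `d`th root of unity").
[cite: Swan1963, §6 (p. 97)] -/
@[simp]
theorem toCyclotomicFactor_of_generator :
    toCyclotomicFactor k σ hσ hd (MonoidAlgebra.of k G σ) = AdjoinRoot.root _ := by
  have h := toCyclotomicFactor_aeval k σ hσ hd X
  rwa [aeval_X] at h

/-- **The projection `k[G] → k[X]/(Φ_d)` is onto** ("`ℤπ → 𝔬_d` is onto").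
[cite: Swan1963, §6 (p. 97)] -/
theorem toCyclotomicFactor_surjective : Function.Surjective (toCyclotomicFactor k σ hσ hd) := by
  intro y
  obtain ⟨P, rfl⟩ := AdjoinRoot.mk_surjective y
  exact ⟨aeval (MonoidAlgebra.of k G σ) P, toCyclotomicFactor_aeval k σ hσ hd P⟩

/-- **"its kernel is the ideal of `ℤπ` generated by `Φ_d(x)`"**: the kernel of `k[G] → k[X]/(Φ_d)`
is the principal ideal `(Φ_d(σ))`, over every commutative ring `k`. [cite: Swan1963, §6 (p. 97)] -/
theorem ker_toCyclotomicFactor :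
    RingHom.ker (toCyclotomicFactor k σ hσ hd) =
      Ideal.span {aeval (MonoidAlgebra.of k G σ) (cyclotomic d k)} := by
  refine le_antisymm (fun x hx => ?_) ((Ideal.span_singleton_le_iff_mem _).2 ?_)
  · obtain ⟨y, rfl⟩ := (groupRingEquiv k σ hσ).surjective x
    obtain ⟨P, rfl⟩ := AdjoinRoot.mk_surjective y
    rw [RingHom.mem_ker, toCyclotomicFactor_groupRingEquiv_mk, AdjoinRoot.mk_eq_zero] at hx
    obtain ⟨q, rfl⟩ := hx
    rw [map_mul, map_mul, groupRingEquiv_mk]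
    exact Ideal.mul_mem_right _ _ (Ideal.mem_span_singleton_self _)
  · rw [RingHom.mem_ker, toCyclotomicFactor_aeval, AdjoinRoot.mk_self]

end Factor

/-! ## §3 `k[G] ≅ Π_{d ∣ |G|} k[X]/(Φ_d)`, `σ ↦ (ζ_d)_d` (`|G| ∈ kˣ`) -/

section Pi

variable (k : Type u) [CommRing k] {G : Type u} [CommGroup G] [Fintype G] (σ : G)
  (hσ : ∀ x, x ∈ Subgroup.zpowers σ) (hu : IsUnit (Fintype.card G : k))

/-- **`k[G] ≅ Π_{d ∣ n} k[X]/(Φ_d)` as `k`-algebras (`G = ⟨σ⟩` cyclic of order `n ∈ kˣ`),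
`σ ↦ (ζ_d)_{d ∣ n}`**: "`ℚπ` is the direct sum of the cyclotomic fields `K_d` … where `d` runs over
the divisors of `n`" — `k[G] ≅ k[X]/(Xⁿ - 1)` (`groupRingEquiv`) followed by the Chinese remainder
theorem (`adjoinRootXPowSubOneEquivPi`). [cite: Swan1963, §6 (p. 97)] -/
def groupRingEquivPi :
    MonoidAlgebra k G ≃ₐ[k] Π d : (Fintype.card G).divisors, AdjoinRoot (cyclotomic (d : ℕ) k) :=
  (groupRingEquiv k σ hσ).symm.trans (adjoinRootXPowSubOneEquivPi k (Fintype.card G) hu)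

/-- On `k[X]/(Xⁿ - 1) ≅ k[G]`: `P̄ ↦ (P̄)_d`. [cite: Swan1963, §6 (p. 97)] -/
theorem groupRingEquivPi_groupRingEquiv_mk (P : k[X]) :
    groupRingEquivPi k σ hσ hu (groupRingEquiv k σ hσ (AdjoinRoot.mk _ P)) =
      fun d : (Fintype.card G).divisors => AdjoinRoot.mk (cyclotomic (d : ℕ) k) P := by
  rw [groupRingEquivPi, AlgEquiv.trans_apply, AlgEquiv.symm_apply_apply, adjoinRootXPowSubOneEquivPi_mk]

/-- **`σ ↦ (ζ_d)_{d ∣ n}`** ("takes `x` into a primitive `d`th root of unity" in each factor).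
[cite: Swan1963, §6 (p. 97)] -/
@[simp]
theorem groupRingEquivPi_of_generator :
    groupRingEquivPi k σ hσ hu (MonoidAlgebra.of k G σ) =
      fun d : (Fintype.card G).divisors => AdjoinRoot.root (cyclotomic (d : ℕ) k) := by
  rw [groupRingEquivPi, AlgEquiv.trans_apply, groupRingEquiv_symm_of_generator,
    adjoinRootXPowSubOneEquivPi_root]

/-- The `d`-th component of `k[G] ≅ Π_{d ∣ n} k[X]/(Φ_d)` is the projection `toCyclotomicFactor`
("The projection `ℚπ → K_d`"). [cite: Swan1963, §6 (p. 97)] -/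
theorem groupRingEquivPi_apply (x : MonoidAlgebra k G) (d : (Fintype.card G).divisors) :
    groupRingEquivPi k σ hσ hu x d = toCyclotomicFactor k σ hσ (Nat.dvd_of_mem_divisors d.2) x := by
  obtain ⟨y, rfl⟩ := (groupRingEquiv k σ hσ).surjective x
  obtain ⟨P, rfl⟩ := AdjoinRoot.mk_surjective y
  rw [groupRingEquivPi_groupRingEquiv_mk, toCyclotomicFactor_groupRingEquiv_mk]

end Pi

/-! ## §4 `k = ℚ`: `ℚ[G] ≅ Π_{d ∣ n} ℚ(ζ_d)` -/

section Rat

variable {G : Type} [CommGroup G] [Fintype G] (σ : G) (hσ : ∀ x, x ∈ Subgroup.zpowers σ)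

/-- `|G| ≠ 0` in `ℚ`. [cite: Swan1963, §6 (p. 97)] -/
theorem isUnit_natCast_card_rat : IsUnit (Fintype.card G : ℚ) :=
  (Nat.cast_ne_zero.2 Fintype.card_ne_zero : (Fintype.card G : ℚ) ≠ 0).isUnit

/-- A divisor of `n` is `≠ 0` (for the `NeZero` hypotheses of the cyclotomic API). [folklore] -/
private theorem neZero_coe_divisors {n : ℕ} (d : n.divisors) : NeZero (d : ℕ) :=
  ⟨(Nat.pos_of_mem_divisors d.2).ne'⟩

variable (K : (Fintype.card G).divisors → Type) [∀ d, Field (K d)] [∀ d, CharZero (K d)]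
  [∀ d : (Fintype.card G).divisors, IsCyclotomicExtension {(d : ℕ)} ℚ (K d)]

/-- **"If `π` is cyclic of order `n`, `ℚπ` is the direct sum of the cyclotomic fields
`K_d = ℚ(e(d⁻¹))` where `d` runs over the divisors of `n`"**: `ℚ[G] ≃ₐ[ℚ] Π_{d ∣ n} K_d` for ANY
family of `d`-th cyclotomic fields `K_d`, `σ ↦ (ζ_d)_d`. [cite: Swan1963, §6 (p. 97)] -/
def ratGroupRingEquivPi : MonoidAlgebra ℚ G ≃ₐ[ℚ] Π d, K d :=
  (groupRingEquivPi ℚ σ hσ isUnit_natCast_card_rat).trans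
    (AlgEquiv.piCongrRight fun d =>
      haveI := neZero_coe_divisors d
      adjoinRootCyclotomicRatEquiv (n := (d : ℕ)) (K d))

/-- **`σ ↦ (ζ_d)_{d ∣ n}` with `ζ_d = IsCyclotomicExtension.zeta d ℚ K_d`** (the `d`-th component
of the image of the generator; `NeZero d` supplied from `d ∣ n`). [cite: Swan1963, §6 (p. 97)] -/
theorem ratGroupRingEquivPi_of_generator_apply (d : (Fintype.card G).divisors) :
    ratGroupRingEquivPi σ hσ K (MonoidAlgebra.of ℚ G σ) d =
      (haveI : NeZero (d : ℕ) := ⟨(Nat.pos_of_mem_divisors d.2).ne'⟩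
       IsCyclotomicExtension.zeta (d : ℕ) ℚ (K d)) := by
  haveI := neZero_coe_divisors d
  rw [ratGroupRingEquivPi, AlgEquiv.trans_apply, AlgEquiv.piCongrRight_apply,
    groupRingEquivPi_of_generator, adjoinRootCyclotomicRatEquiv_root]

/-- **"If `x` is a generator of `π`, this map takes `x` into a primitive `d`th root of unity"**:
every component of the image of `σ` under `ℚ[G] ≅ Π_{d ∣ n} K_d` is a primitive `d`-th root of
unity. [cite: Swan1963, §6 (p. 97)] -/
theorem isPrimitiveRoot_ratGroupRingEquivPi_of_generator (d : (Fintype.card G).divisors) :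
    IsPrimitiveRoot (ratGroupRingEquivPi σ hσ K (MonoidAlgebra.of ℚ G σ) d) d := by
  haveI := neZero_coe_divisors d
  rw [ratGroupRingEquivPi_of_generator_apply]
  exact IsCyclotomicExtension.zeta_spec (d : ℕ) ℚ (K d)

/-- The `d`-th component of `ℚ[G] ≅ Π K_d` is `P(σ) ↦ P(ζ_d)` ("The projection `ℚπ → K_d`").
[cite: Swan1963, §6 (p. 97)] -/
theorem ratGroupRingEquivPi_aeval (P : ℚ[X]) (d : (Fintype.card G).divisors) :
    ratGroupRingEquivPi σ hσ K (aeval (MonoidAlgebra.of ℚ G σ) P) d =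
      aeval (ratGroupRingEquivPi σ hσ K (MonoidAlgebra.of ℚ G σ) d) P := by
  rw [← AlgEquiv.coe_toAlgHom, ← aeval_algHom_apply]
  exact (aeval_algHom_apply (Pi.evalAlgHom ℚ (fun d => K d) d) _ P).symm

/-- **`ℚ[G] ≅ Π_{d ∣ n} ℚ(ζ_d)`** with Mathlib's model `CyclotomicField d ℚ` of `ℚ(ζ_d)`.
[cite: Swan1963, §6 (p. 97)] -/
def ratGroupRingEquivCyclotomicFields :
    MonoidAlgebra ℚ G ≃ₐ[ℚ] Π d : (Fintype.card G).divisors, CyclotomicField d ℚ :=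
  haveI : ∀ d : (Fintype.card G).divisors, IsCyclotomicExtension {((d : ℕ))} ℚ (CyclotomicField d ℚ) :=
    fun d =>
      haveI := neZero_coe_divisors d
      CyclotomicField.isCyclotomicExtension d ℚ
  ratGroupRingEquivPi σ hσ fun d => CyclotomicField d ℚ

omit [CommGroup G] in
/-- **Dimension count `Σ_{d ∣ n} [K_d : ℚ] = Σ_{d ∣ n} φ(d) = n = dim ℚ[G]`.**
[cite: Swan1963, §6 (p. 97)] -/
theorem finrank_rat_pi_cyclotomicField : Module.finrank ℚ (Π d, K d) = Fintype.card G := by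
  haveI : ∀ d : (Fintype.card G).divisors, Module.Finite ℚ (K d) := fun d =>
    IsCyclotomicExtension.finite {((d : ℕ))} ℚ (K d)
  rw [Module.finrank_pi_fintype]
  conv_rhs => rw [← Nat.sum_totient (Fintype.card G), ← Finset.sum_coe_sort]
  refine Finset.sum_congr rfl fun d _ => ?_
  haveI := neZero_coe_divisors d
  exact finrank_rat_cyclotomicField_eq_totient (K d) (n := d)

omit [CommGroup G] in
/-- `dim_ℚ ℚ[G] = |G|`. [cite: Swan1963, §6 (p. 97)] -/
theorem finrank_rat_monoidAlgebra : Module.finrank ℚ (MonoidAlgebra ℚ G) = Fintype.card G :=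
  Module.finrank_eq_card_basis (MonoidAlgebra.basis G ℚ)

end Rat

/-! ## §5 `k = ℤ`, `d = p ^ j`: `ℤ[G] → 𝓞(ℚ(ζ_{p^j}))` is onto with kernel `(Φ_{p^j}(σ))` -/

section Int

variable {p : ℕ} [hp : Fact p.Prime] {j : ℕ} (K : Type) [Field K] [CharZero K]
  [IsCyclotomicExtension {p ^ j} ℚ K]

/-- **`ℤ[X]/(Φ_{p^j}) ≅ 𝓞(ℚ(ζ_{p^j}))`, `X̄ ↦ ζ_{p^j}`** ("the roots of unity form an integral base of
`𝔬_d`"; Mathlib `IsPrimitiveRoot.adjoinEquivRingOfIntegersOfPrimePow`). [cite: Swan1963, §6 (p. 97)] -/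
def adjoinRootCyclotomicPrimePowEquivRingOfIntegers :
    AdjoinRoot (cyclotomic (p ^ j) ℤ) ≃ₐ[ℤ] NumberField.RingOfIntegers K :=
  have hζ : IsPrimitiveRoot (IsCyclotomicExtension.zeta (p ^ j) ℚ K) (p ^ j) :=
    IsCyclotomicExtension.zeta_spec (p ^ j) ℚ K
  (AdjoinRoot.algEquivOfEq ℤ _ _ (cyclotomic_eq_minpoly hζ (pow_pos hp.out.pos _))).trans
    ((minpoly.equivAdjoin (hζ.isIntegral (pow_pos hp.out.pos _))).trans
      hζ.adjoinEquivRingOfIntegersOfPrimePow)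

/-- `X̄ ↦ ζ_{p^j}`. [cite: Swan1963, §6 (p. 97)] -/
theorem coe_adjoinRootCyclotomicPrimePowEquivRingOfIntegers_root :
    ((adjoinRootCyclotomicPrimePowEquivRingOfIntegers K (p := p) (j := j) (AdjoinRoot.root _) :
        NumberField.RingOfIntegers K) : K) = IsCyclotomicExtension.zeta (p ^ j) ℚ K := by
  rw [adjoinRootCyclotomicPrimePowEquivRingOfIntegers]
  simp only [AlgEquiv.trans_apply, AdjoinRoot.algEquivOfEq_root,
    IsPrimitiveRoot.adjoinEquivRingOfIntegersOfPrimePow_apply, minpoly.coe_equivAdjoin,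
    IsIntegralClosure.algebraMap_lift]
  exact AdjoinRoot.Minpoly.coe_toAdjoin_mk_X

variable {G : Type} [CommGroup G] [Fintype G] (σ : G) (hσ : ∀ x, x ∈ Subgroup.zpowers σ)
  (hd : p ^ j ∣ Fintype.card G)

/-- **"The projection `ℚπ → K_d` sends `ℤπ` into `𝔬_d`"**: `ℤ[G] → 𝓞(ℚ(ζ_{p^j}))`, `σ ↦ ζ_{p^j}`,
for `p^j ∣ |G|`. [cite: Swan1963, §6 (p. 97)] -/
def intToRingOfIntegers : MonoidAlgebra ℤ G →ₐ[ℤ] NumberField.RingOfIntegers K :=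
  (adjoinRootCyclotomicPrimePowEquivRingOfIntegers K (p := p) (j := j)).toAlgHom.comp
    (toCyclotomicFactor ℤ σ hσ hd)

/-- `σ ↦ ζ_{p^j}` ("takes `x` into a primitive `d`th root of unity"). [cite: Swan1963, §6 (p. 97)] -/
theorem coe_intToRingOfIntegers_of_generator :
    ((intToRingOfIntegers K σ hσ hd (MonoidAlgebra.of ℤ G σ) : NumberField.RingOfIntegers K) : K) =
      IsCyclotomicExtension.zeta (p ^ j) ℚ K := by
  rw [intToRingOfIntegers, AlgHom.comp_apply, toCyclotomicFactor_of_generator, AlgEquiv.toAlgHom_apply,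
    coe_adjoinRootCyclotomicPrimePowEquivRingOfIntegers_root]

/-- **"`ℤπ → 𝔬_d` is onto"** (`d = p^j`). [cite: Swan1963, §6 (p. 97)] -/
theorem intToRingOfIntegers_surjective : Function.Surjective (intToRingOfIntegers K σ hσ hd) := by
  intro y
  obtain ⟨x, hx⟩ := toCyclotomicFactor_surjective ℤ σ hσ hd
    ((adjoinRootCyclotomicPrimePowEquivRingOfIntegers K (p := p) (j := j)).symm y)
  refine ⟨x, ?_⟩
  rw [intToRingOfIntegers, AlgHom.comp_apply, hx, AlgEquiv.toAlgHom_apply, AlgEquiv.apply_symm_apply]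

/-- **"and its kernel is the ideal of `ℤπ` generated by `Φ_d(x)`"** (`d = p^j`).
[cite: Swan1963, §6 (p. 97)] -/
theorem ker_intToRingOfIntegers :
    RingHom.ker (intToRingOfIntegers K σ hσ hd) =
      Ideal.span {aeval (MonoidAlgebra.of ℤ G σ) (cyclotomic (p ^ j) ℤ)} := by
  rw [← ker_toCyclotomicFactor ℤ σ hσ hd]
  ext x
  rw [RingHom.mem_ker, RingHom.mem_ker, intToRingOfIntegers, AlgHom.comp_apply, AlgEquiv.toAlgHom_apply,
    EmbeddingLike.map_eq_zero_iff]

end Int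

end CyclicGroupRing

end Literature.Algebra.Homology
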